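import Mathlib
import HarnessLib
import Literature.Dynamics.TransferOperators.MayerTransferOperatorHolomorphy
import Summits.RiemannHypothesis.RiemannHypothesis.Theses.MayerPairing
import Summits.RiemannHypothesis.RiemannHypothesis.Theorems.MayerPairingEigenvaluePredicate
import Summits.RiemannHypothesis.RiemannHypothesis.Theorems.MayerPairingBranchPairingWeinsteinAronszajn
import Summits.RiemannHypothesis.RiemannHypothesis.Theorems.MayerPairingBranchPairingSelectionDefs
import Summits.RiemannHypothesis.RiemannHypothesis.Theorems.MayerPairingBranchPairingTubeSpectrumData
import Summits.RiemannHypothesis.RiemannHypothesis.Theorems.MayerPairingBranchPairingFiniteSetSelection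

/-!
# Crux `MayerPairing.BranchPairing` (stmt-RiemannHypothesis-1471), line `weinstein-aronszajn-pinning`:
Kato selection closed, and the reduction `PinnedTube → BranchPairing`

(1) The planner's STUB 2 — `KatoSelection` (continuous eigenvalue selection inside a resolvent tube
of a norm-continuous compact family over a real interval; Kato 1966 II-§5.2 Thm 5.2 with IV-§3.4–3.5)
— is PROVED, unconditionally and ζ-free, by assembling the lead's reshape: `stub_tubeSpectrumData`
(= `tubeSpectrumData_main`) and `stub_finiteSetSelection` (= `finiteSetSelection_main`), glued by
`katoSelection_of`: `katoSelection_proof`.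
(2) The composition of the line, with every ζ-free stub discharged: `BranchPairing_of :
WeinsteinAronszajn → KatoSelection → PinnedTube → BranchPairing` (kernel-checked) and, plugging in
the landed `stub_weinsteinAronszajn` and `katoSelection_proof`, the CONDITIONAL result
`branchPairing_of_pinnedTube : PinnedTube → BranchPairing` (registered sub-goal of
stmt-RiemannHypothesis-1471). `PinnedTube` — a continuous resolvent circle around the frozen
Eisenstein eigenvalue of the pinned operator `L̃_s = L_s + c(s)·𝟙⊗δ₀` along the segment of an
OFF-LINE zero, with `‖c G̃‖ < 1` on it and isolation of `1` at the two endpoints — is the RH-strength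
residue of the crux (vacuous under RH; Cruxes/BranchPairing/Disproof.lean §1: modulo the dictionary
and `UnitCircleCrossedOnce`, `BranchPairing ↔` RH in the quarter-strip). Everything else in the
line is now a theorem of functional analysis in the tree.

Mechanism: on-line zeros — the segment is the point `σ = 1/4`, `Λ ≡ 1` by the dictionary
(`one_mem_spectrum_mayerTransfer_of_zeta`); off-line zeros — the tube's circle lies in `res L̃_s`
with `‖c G̃‖ < 1`, hence in `res L_s` by the Weinstein–Aronszajn secular equation; Kato selection
along the continuous compact family `σ ↦ L_{σ + i Im ρ/2}` (`MayerTransferHolomorphic_holds`,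
`MayerTransferCompact_holds`) from the spectral point `1 ∈ spec L_{ρ/2}`; at both endpoints `c = 0`,
`L̃ = L`, and the isolation clause pins `Λ = 1` (right endpoint via `ζ(1 − conj ρ) = 0`); non-zero
spectral points of the compact `L_s` are eigenvalues (Fredholm alternative) and the predicate bridge
`mayerPairing_branchPairing_iff_operator` returns to the route's inlined statement.
-/

noncomputable section

namespace Summit.RiemannHypothesis.RiemannHypothesis.Theorems.MayerPairingPinning

open Filter Topology Set
open Literature.Dynamics.TransferOperators
open Summit.RiemannHypothesis.RiemannHypothesis.Theses.MayerPairing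

/-! ## Kato selection in a resolvent tube (STUB 2), closed -/

/-- STUB 2a of the line (registered `stub_tubeSpectrumData`): the spectral slices
`spec (T σ) ∩ ball 1 (δ σ)` in a resolvent tube of a norm-continuous compact family are non-empty,
uniformly finite, of closed graph and lower semicontinuous. [folklore] -/
theorem stub_tubeSpectrumData : TubeSpectrumData := tubeSpectrumData_main

/-- STUB 2b of the line (registered `stub_finiteSetSelection`): continuous selection, through a
prescribed point of the graph, of a finite-set-valued lower semicontinuous closed-graph map over a
compact real interval (Kato II-§5.2 Thm 5.2 in set form). [folklore] -/
theorem stub_finiteSetSelection : FiniteSetSelection := finiteSetSelection_main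

/-- **Kato selection in a resolvent tube** (the planner's STUB 2 of the line, `KatoSelection`): for
a norm-continuous family `σ ↦ T σ` of compact operators on a complex Banach space over `[a, b]`, a
continuous radius `0 < δ σ < 1` whose circle `‖μ − 1‖ = δ σ` never meets `spec (T σ)`, and a
spectral point inside at `σ = a`, there is a continuous `Λ` on `[a, b]` with `Λ σ ∈ spec (T σ)` and
`‖Λ σ − 1‖ < δ σ`. Unconditional; ζ-free. [folklore] -/
theorem katoSelection_proof : KatoSelection :=
  katoSelection_of stub_tubeSpectrumData stub_finiteSetSelection

/-! ## The composition -/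

/-- Norm-continuity of `σ ↦ L_{σ + i Im ρ/2}` on a segment `[a, b]` with `0 < a` when `Im ρ ≠ 0`
(from the holomorphy of `s ↦ L_s`, `MayerTransferHolomorphic_holds`). [folklore] -/
theorem continuousOn_mayerTransfer_sPar {ρ : ℂ} (him : ρ.im ≠ 0) {a b : ℝ} (ha : 0 < a) :
    ContinuousOn (fun σ : ℝ => mayerTransfer (sPar σ ρ)) (Icc a b) := by
  have hL : ContinuousOn (fun s : ℂ => mayerTransfer s) {s : ℂ | 0 < s.re ∧ s ≠ 1 / 2} :=
    MayerTransferHolomorphic_holds.continuousOn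
  have hs : ContinuousOn (fun σ : ℝ => sPar σ ρ) (Icc a b) := (continuous_sPar ρ).continuousOn
  refine hL.comp hs fun σ hσ => ?_
  exact sPar_ok (ha.trans_le hσ.1) him

/-- **The composition of the line.** `WeinsteinAronszajn → KatoSelection → PinnedTube →
BranchPairing`. On-line zeros: the segment is the point `σ = 1/4` and `Λ ≡ 1` by the dictionary
(`one_mem_spectrum_mayerTransfer_of_zeta`). Off-line zeros: the pinned tube (STUB 3) gives a moving
circle in `res L̃_s` with `‖c G̃‖ < 1`, hence (STUB 1) in `res L_s`; Kato selection (STUB 2) applied to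
the continuous compact family `σ ↦ L_{σ + i Im ρ/2}` with the spectral point `1 ∈ spec L_{ρ/2}`
inside at the left end gives a continuous `Λ` in the tube; at both endpoints `c = 0`, `L̃ = L`, and
clause (ii) of the tube pins `Λ = 1`; nonzero spectral points of the compact `L_s` are eigenvalues
(Fredholm alternative), and the predicate bridge `mayerPairing_branchPairing_iff_operator` returns to
the route's inlined statement. -/
theorem BranchPairing_of (hWA : WeinsteinAronszajn) (hK : KatoSelection) (hT : PinnedTube) :
    BranchPairing := by
  rw [mayerPairing_branchPairing_iff_operator]
  intro ρ hζ h0 hle h14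
  have him : ρ.im ≠ 0 := by intro h; rw [h] at h14; norm_num at h14
  rcases eq_or_lt_of_le hle with heq | hlt
  · -- ON-LINE zero: the segment is a point, `Λ ≡ 1`, dictionary at `s = ρ/2`
    refine ⟨fun _ => 1, continuousOn_const, rfl, rfl, fun σ hσ => ?_⟩
    have hσ' : σ = ρ.re / 2 := by
      obtain ⟨h1, h2⟩ := hσ
      rw [heq] at h1 h2 ⊢
      linarith
    refine ⟨one_ne_zero, ?_⟩
    have hs0 : 0 < (sPar σ ρ).re := by rw [sPar_re]; linarith [hσ.1]
    have hs1 : (sPar σ ρ).re < 1 / 2 := by rw [sPar_re, hσ', heq]; norm_num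
    have hζ2 : riemannZeta (2 * sPar σ ρ) = 0 := by rw [hσ', two_mul_sPar_left]; exact hζ
    obtain ⟨g, hg, hLg⟩ := exists_eigenvector_of_mem_spectrum hs0 (sPar_ok (by linarith [hσ.1]) him).2
      one_ne_zero (one_mem_spectrum_mayerTransfer_of_zeta hs0 hs1 hζ2)
    exact ⟨g, hg, hLg⟩
  · -- OFF-LINE zero: pinned tube + Weinstein–Aronszajn + Kato selection
    obtain ⟨δ, hδc, hδ⟩ := hT ρ hζ h0 hlt h14
    set a : ℝ := ρ.re / 2 with ha_def
    set b : ℝ := (1 - ρ.re) / 2 with hb_def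
    have ha0 : 0 < a := by rw [ha_def]; linarith
    have hab : a ≤ b := by rw [ha_def, hb_def]; linarith
    -- parameters on the segment are admissible for `L_s`
    have hpar : ∀ σ ∈ Icc a b, 0 < (sPar σ ρ).re ∧ sPar σ ρ ≠ 1 / 2 := fun σ hσ =>
      sPar_ok (ha0.trans_le hσ.1) him
    -- the circle of the tube lies in the resolvent set of `L_s` (STUB 1)
    have hcirc : ∀ σ ∈ Icc a b, ∀ μ : ℂ, ‖μ - 1‖ = δ σ →
        μ ∉ spectrum ℂ (mayerTransfer (sPar σ ρ)) := by
      intro σ hσ μ hμ hmem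
      obtain ⟨hnot, hsmall⟩ := (hδ σ hσ).2.2.1 μ hμ
      have hsec : 1 + pinCoeff (sPar σ ρ) * pinnedG (sPar σ ρ) μ = 0 := (hWA _ μ hnot).1 hmem
      have h1 : pinCoeff (sPar σ ρ) * pinnedG (sPar σ ρ) μ = -1 := by linear_combination hsec
      rw [h1, norm_neg, norm_one] at hsmall
      exact lt_irrefl _ hsmall
    -- the spectral point `1 ∈ spec L_{ρ/2}` inside the circle at the left end (dictionary)
    have hleft1 : (1 : ℂ) ∈ spectrum ℂ (mayerTransfer (sPar a ρ)) := by
      refine one_mem_spectrum_mayerTransfer_of_zeta (by rw [sPar_re]; exact ha0)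
        (by rw [sPar_re]; linarith) ?_
      rw [ha_def, two_mul_sPar_left]; exact hζ
    -- Kato selection (STUB 2)
    obtain ⟨Λ, hΛc, hΛ⟩ := hK MayerSpace (fun σ => mayerTransfer (sPar σ ρ)) δ a b hab
      (continuousOn_mayerTransfer_sPar him ha0) hδc
      (fun σ hσ => MayerTransferCompact_holds _ (hpar σ hσ).1 (hpar σ hσ).2)
      (fun σ hσ => ⟨(hδ σ hσ).1, (hδ σ hσ).2.1⟩) hcirc
      ⟨1, hleft1, by rw [sub_self, norm_zero]; exact (hδ a (left_mem_Icc.2 hab)).1⟩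
    -- endpoint pinning (clause (ii) of the tube, `c = 0` there)
    have hend : ∀ σ ∈ Icc a b, (σ = ρ.re / 2 ∨ σ = (1 - ρ.re) / 2) →
        riemannZeta (2 * sPar σ ρ) = 0 → Λ σ = 1 := by
      intro σ hσ hend hζσ
      obtain ⟨hin, hmem⟩ := hΛ σ hσ
      have hpin : pinnedTransfer (sPar σ ρ) = mayerTransfer (sPar σ ρ) :=
        pinnedTransfer_eq_of_pinCoeff_eq_zero (pinCoeff_eq_zero_of_zeta hζσ)
      refine (hδ σ hσ).2.2.2 hend (Λ σ) ?_ hin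
      rw [hpin]; exact hmem
    refine ⟨Λ, hΛc, ?_, ?_, fun σ hσ => ?_⟩
    · exact hend a (left_mem_Icc.2 hab) (Or.inl rfl) (by rw [ha_def, two_mul_sPar_left]; exact hζ)
    · refine hend b (right_mem_Icc.2 hab) (Or.inr rfl) ?_
      rw [hb_def, two_mul_sPar_right]
      exact riemannZeta_one_sub_conj_eq_zero hζ h0 him
    · obtain ⟨hin, hmem⟩ := hΛ σ hσ
      have hΛ0 : Λ σ ≠ 0 := by
        intro h0'
        rw [h0', zero_sub, norm_neg, norm_one] at hin
        exact lt_irrefl _ (hin.trans (hδ σ hσ).2.1)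
      exact ⟨hΛ0, exists_eigenvector_of_mem_spectrum (hpar σ hσ).1 (hpar σ hσ).2 hΛ0 hmem⟩

/-- **`PinnedTube → BranchPairing`** (registered sub-goal `branchPairing_of_pinnedTube` of
stmt-RiemannHypothesis-1471): the crux of route MayerPairing CONDITIONAL on the single RH-strength
stub of the line; the Weinstein–Aronszajn and Kato-selection inputs are theorems
(`stub_weinsteinAronszajn`, `katoSelection_proof`). -/
theorem branchPairing_of_pinnedTube : PinnedTube → BranchPairing :=
  BranchPairing_of stub_weinsteinAronszajn katoSelection_proof

end Summit.RiemannHypothesis.RiemannHypothesis.Theorems.MayerPairingPinning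

end
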